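import Mathlib
import HarnessLib
import Summits.HubbardSuperconductivity.HubbardSuperconductivity.Theorems.KLProgrammeKLRegimeEngineTowerBlockIncrWtKitUnits

/-!
# Route `KLProgramme` — crux K3 ENGINE (stmt-HubbardSuperconductivity-20437 `KLRegimeEngineV17F2`), stub (b) v2, THE LEVELS PACKAGE (ℓ):
# instantiation (I1-dim), THE DICTIONARY — the kit's `hstep` on the flow frame with MANIFESTLY k-FREE constants `(σ, τ, Φ, ψ, cr, cc)` in closed form
# (continuation of `…TowerBlockIncrWtKitUnits` (p637770); E1-TOWER-BLOCKED §4 «x_k scale-free», E1-LEVELS-BLUEPRINT-g8 §9; the numbers the located check «(ℓ)-C-DOOR»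
#  (C-DOOR-CALC.md, evidence #58) tabled; cell gate-hubbard-kl, seat hubbard-kl-k3c3-p2 g13 as substitute typer; located «(I1)-HSTEP-KIT-FORM»)

`klTowerBornWtAt_le_klEng_all_kit_units` gives the kit's step right side for ANY units `(u, Kc)` with the block data `κ, α, cr, cc` bound by the tree's EQUATIONS
(`κ = √(Cκ·(Λ_{dk}/Λ_{dk−1})·e₀·8^{−(dk−1)})`, `α = Cb·(M/β)/Λ_{d(k+1)}`, `cr = 81·CJ·M/β`, `cc = 81·2^{dk−(dk−1)}·CJ′·M/β`).  At the block's own units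
`u := 8^{dk}`, `Kc := 2^{−5dk}` and the field radius `ρ := θ·κ` (`θ > 0` free) every constant of the right side is a CLOSED FORM FREE OF `k, n, L, M, β, U, μ`:
`σ = κ²u = 2·Cκ·e₀`, `τ = (e²(κ+ρ))²u = e⁴(1+θ)²·2Cκe₀`, `ψ = ρ⁻²/u = 1/(θ²·2Cκe₀)`, `Φ = (eα/κ²)·ε·Kc = 256·e·Cb·4^d/Cκ`, `ε·cr = 81CJ/2`, `ε·cc = 81CJ′` (`e₀ = klE0 = 1/32`,
`ε = imagTimeWeight β M`):

* §1 the six dictionary identities (`towerDict_sigma`, `towerDict_tau`, `towerDict_psi`, `towerDict_Phi`, `towerDict_cr`, `towerDict_cc`) + `towerDict_klScale_ratio_pred`, power bookkeeping;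
* §2 **`klTowerBornWtAt_le_klEng_all_hstep`** — under the binders of `klWtPinnedSumAt_klTowerIncr_le_klEng_all` (p633669), for every `θ > 0`, degree cap `D` and the
  DIMENSIONLESS kit guard `Φ·towerV D τ μ < 1` (`μ m := klTowerMeasWtAt … d k j (2m)/(2^{−5dk}·8^{dk·m})`):
  `klTowerBornWtAt … d k j (2(q+1)) ≤ (81CJ/2)·(81CJ′)^{2q+1}·(8^{dk(q+1)}·2^{−5dk})·[towerFO D σ μ (q+1) + Σ_{n∈Icc 2 (N₀−1)} e·Φ^{n−1}·ψ^{q+1}·towerS D τ μ n (q+1) +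
  ψ^{q+1}·e·towerV D τ μ·(Φ·towerV D τ μ)^{N₀−1}/(1 − Φ·towerV D τ μ)]` with the closed forms above — i.e. `hstep` of `towerBorn_le_law_split` for the born array
  `b (k+1) p := klTowerBornWtAt … (2p)/((81CJ/2)(81CJ′)^{2p−1}·8^{dkp}·2^{−5dk})` and the measured array `μ k`, at k-FREE `(σ, τ, Φ, ψ)`.
Compositions of landed theorems + real arithmetic; nothing about the model is asserted beyond them; nothing asserts any stub, (ℓ), K3 or superconductivity.
References: BGM 2006 §2.8 (2.80)–(2.83), §3 (3.2)–(3.8) [cite: BenfattoGiulianiMastropietro2006].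
-/

noncomputable section

namespace Summit.HubbardSuperconductivity.HubbardSuperconductivity.Theorems.EngineV8

set_option linter.dupNamespace false -- summit = problem name (single-conjunct summit), D-0017

open Real Finset Literature.MathematicalPhysics.QuantumLattice Literature.Probability.LatticeModels GrassmannAlgebra
open Literature.MathematicalPhysics.QuantumLattice.BandSectorCounting
open Summit.HubbardSuperconductivity.HubbardSuperconductivity.Theorems.KLProgrammeLegKernels
open Summit.HubbardSuperconductivity.HubbardSuperconductivity.Theorems.KLRegimeSplit
open Summit.HubbardSuperconductivity.HubbardSuperconductivity.Theorems.KLRegimeWick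
open Summit.HubbardSuperconductivity.HubbardSuperconductivity.Theorems.TwoPointAssembly
open Summit.HubbardSuperconductivity.HubbardSuperconductivity.Theorems.TorusFourierL2
open Summit.HubbardSuperconductivity.HubbardSuperconductivity.Theorems.DispersionFlow
open Literature.Probability.LatticeModels.BattleFederbush

/-! ## §1 The dictionary identities (pure real arithmetic on the tree's equational binders) -/

/-- `8^n = 2^{3n}` over `ℝ`. -/
theorem towerDict_eight_pow (n : ℕ) : (8 : ℝ) ^ n = 2 ^ (3 * n) := by
  rw [pow_mul]; norm_num

/-- `4^n = 2^{2n}` over `ℝ`. -/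
theorem towerDict_four_pow (n : ℕ) : (4 : ℝ) ^ n = 2 ^ (2 * n) := by
  rw [pow_mul]; norm_num

/-- `klScale e₀ (j+1) / klScale e₀ j`-type ratio: `klScale klE0 (dk) / klScale klE0 (dk-1) = 1/4` for `1 ≤ dk`. -/
theorem towerDict_klScale_ratio_pred {m : ℕ} (hm : 1 ≤ m) : klScale klE0 m / klScale klE0 (m - 1) = 1 / 4 := by
  obtain ⟨j, rfl⟩ : ∃ j, m = j + 1 := ⟨m - 1, by omega⟩
  simp only [Nat.add_sub_cancel]
  unfold klScale klE0
  rw [pow_succ]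
  have h4 : (4 : ℝ) ^ j ≠ 0 := pow_ne_zero _ (by norm_num)
  field_simp

/-- (D-κ) `κ² · 8^{dk} = 2·Cκ·klE0`. -/
theorem towerDict_sigma {Cκ κ : ℝ} (hCκ : 0 ≤ Cκ) {m : ℕ} (hm : 1 ≤ m)
    (hκ : κ = Real.sqrt (Cκ * (klScale klE0 m / klScale klE0 (m - 1)) * (klE0 * ((8 : ℝ) ^ (m - 1))⁻¹))) :
    κ ^ 2 * (8 : ℝ) ^ m = 2 * Cκ * klE0 := by
  have he : (0 : ℝ) < klE0 := by norm_num [klE0]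
  have hin : 0 ≤ Cκ * (klScale klE0 m / klScale klE0 (m - 1)) * (klE0 * ((8 : ℝ) ^ (m - 1))⁻¹) := by
    have := klth_klScale_pos m
    have := klth_klScale_pos (m - 1)
    positivity
  rw [hκ, Real.sq_sqrt hin, towerDict_klScale_ratio_pred hm]
  obtain ⟨j, rfl⟩ : ∃ j, m = j + 1 := ⟨m - 1, by omega⟩
  simp only [Nat.add_sub_cancel]
  rw [pow_succ]
  have h8 : (8 : ℝ) ^ j ≠ 0 := pow_ne_zero _ (by norm_num)
  field_simp
  ring

/-- (D-Φ) `(eα/κ²)·(ε·2^{-5dk}) = 256·e·Cb·4^d/Cκ` for `α = Cb(M/β)/Λ_{d(k+1)}`, `κ²·8^{dk} = 2CκklE0`. -/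
theorem towerDict_Phi {Cκ Cb κ α β : ℝ} {M d k : ℕ} (hCκ : 0 < Cκ) (hβ : 0 < β) (hM : 0 < (M : ℝ))
    (hσ : κ ^ 2 * (8 : ℝ) ^ (d * k) = 2 * Cκ * klE0) (hα : α = Cb * ((M : ℝ) / β) / klScale klE0 (d * (k + 1))) :
    Real.exp 1 * α / κ ^ 2 * (imagTimeWeight β M * ((2 : ℝ) ^ (5 * (d * k)))⁻¹) = 256 * Real.exp 1 * Cb * (4 : ℝ) ^ d / Cκ := by
  have he : (0 : ℝ) < klE0 := by norm_num [klE0]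
  have hκ2 : κ ^ 2 = 2 * Cκ * klE0 / (8 : ℝ) ^ (d * k) := by
    rw [eq_div_iff (pow_ne_zero _ (by norm_num))]; exact hσ
  have hΛ : klScale klE0 (d * (k + 1)) = klE0 * ((4 : ℝ) ^ (d * (k + 1)))⁻¹ := rfl
  rw [hα, hκ2, hΛ, imagTimeWeight]
  unfold klE0
  rw [towerDict_eight_pow, towerDict_four_pow, towerDict_four_pow]
  have h2a : (2 : ℝ) ^ (2 * (d * (k + 1))) = 2 ^ (2 * d) * 2 ^ (2 * (d * k)) := by rw [← pow_add]; congr 1; ring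
  rw [h2a]
  have hx : (2 : ℝ) ^ (2 * (d * k)) ≠ 0 := pow_ne_zero _ (by norm_num)
  have hy : (2 : ℝ) ^ (3 * (d * k)) ≠ 0 := pow_ne_zero _ (by norm_num)
  have hz : (2 : ℝ) ^ (5 * (d * k)) ≠ 0 := pow_ne_zero _ (by norm_num)
  have hw : (2 : ℝ) ^ (2 * d) ≠ 0 := pow_ne_zero _ (by norm_num)
  have h5 : (2 : ℝ) ^ (5 * (d * k)) = 2 ^ (2 * (d * k)) * 2 ^ (3 * (d * k)) := by rw [← pow_add]; congr 1; ring
  rw [h5]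
  field_simp
  ring


/-- (D-τ) with `ρ = θκ`: `(e²(κ+ρ))²·8^{dk} = e⁴(1+θ)²·(2·Cκ·klE0)`. -/
theorem towerDict_tau {Cκ κ θ : ℝ} {m : ℕ} (hσ : κ ^ 2 * (8 : ℝ) ^ m = 2 * Cκ * klE0) :
    (Real.exp 2 * (κ + θ * κ)) ^ 2 * (8 : ℝ) ^ m = Real.exp 1 ^ 4 * (1 + θ) ^ 2 * (2 * Cκ * klE0) := by
  have h2 : Real.exp 2 = Real.exp 1 ^ 2 := by rw [← Real.exp_nat_mul]; norm_num
  rw [← hσ, h2]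
  ring

/-- (D-ψ) with `ρ = θκ`: `ρ⁻²/8^{dk} = 1/(θ²·(2·Cκ·klE0))`. -/
theorem towerDict_psi {Cκ κ θ : ℝ} (hκ : 0 < κ) (hθ : 0 < θ) {m : ℕ} (hσ : κ ^ 2 * (8 : ℝ) ^ m = 2 * Cκ * klE0) :
    (θ * κ)⁻¹ ^ 2 / (8 : ℝ) ^ m = 1 / (θ ^ 2 * (2 * Cκ * klE0)) := by
  rw [← hσ]
  have h8 : (8 : ℝ) ^ m ≠ 0 := pow_ne_zero _ (by norm_num)
  field_simp

/-- (D-cr): `ε·cr = 81·CJ/2` for `cr = 81·CJ·M/β`, `ε = β/(2M)`. -/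
theorem towerDict_cr {β CJ cr : ℝ} {M : ℕ} (hβ : β ≠ 0) (hM : (M : ℝ) ≠ 0) (hcr : cr = 81 * CJ * M / β) :
    imagTimeWeight β M * cr = 81 * CJ / 2 := by
  rw [hcr, imagTimeWeight]; field_simp

/-- (D-cc): `ε·cc = 81·CJ′` for `cc = 81·2^{dk−(dk−1)}·CJ′·M/β`, `1 ≤ dk`. -/
theorem towerDict_cc {β CJ' cc : ℝ} {M m : ℕ} (hβ : β ≠ 0) (hM : (M : ℝ) ≠ 0) (hm : 1 ≤ m) (hcc : cc = 81 * (2 : ℝ) ^ (m - (m - 1)) * CJ' * M / β) :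
    imagTimeWeight β M * cc = 81 * CJ' := by
  rw [hcc, imagTimeWeight, show m - (m - 1) = 1 by omega, pow_one]; field_simp

/-! ## §2 The kit's `hstep` on the flow frame with manifestly k-free constants -/

open Classical in
/-- **THE KIT'S `hstep` AT THE BLOCK'S OWN UNITS — k-FREE CLOSED-FORM CONSTANTS.**  Under the binders of `klWtPinnedSumAt_klTowerIncr_le_klEng_all` (p633669), for every
`θ > 0` (field radius `ρ := θκ`), degree cap `D` and the dimensionless kit guard, with `μ m := klTowerMeasWtAt … d k j (2m)/(2^{−5dk}·8^{dk·m})`: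
the born carrier is bounded by `(81CJ/2)·(81CJ′)^{2q+1}·(8^{dk(q+1)}·2^{−5dk})` times the kit's step right side at
`σ = 2Cκe₀`, `τ = e⁴(1+θ)²·2Cκe₀`, `Φ = 256·e·Cb·4^d/Cκ`, `ψ = 1/(θ²·2Cκe₀)` — constants free of `k, n, L, M, β, U, μ`. -/
theorem klTowerBornWtAt_le_klEng_all_hstep (d : ℕ) (R : RenConsts) (c'' : ℝ) (hc'' : 0 < c'') :
    ∃ Cκ Cb CJ CJ' : ℝ, 0 < Cκ ∧ 0 < Cb ∧ 0 < CJ ∧ 0 < CJ' ∧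
      ∀ (G : GeoConsts) (P : SplitConsts) (Q : EngConsts) (c : ℝ), P.WF → R.WF2 → 0 < c → c ≤ klEngC₃6 P R →
      ∀ μ ∈ klWindowC, ∀ U : ℝ, 0 < U → U ≤ klEngU₀9 P R c → c'' * U ≤ 1 →
      ∀ β : ℝ, klBetaMin ≤ β → β ≤ Real.exp (c / U ^ 2) →
      ∀ (L M : ℕ) [NeZero L] [NeZero M], klEngL₃ β U ≤ L → klEngM₃ β U L ≤ M →
      ∀ n : ℕ, 1 ≤ n → n ≤ nScales β + 1 → IsKLRegime U c (-(n : ℤ)) →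
        HistP klPredsV17F2 L M G P Q R β U μ 0 n → FrameOK R U (nScales β) μ (klFlowFrameU L M β U μ n) →
        (∀ m, 1 ≤ m → m < n → FlowPieceOscAt L M c'' β U μ m) →
      ∀ k : ℕ, 1 ≤ d → 1 ≤ k → 2 ≤ d * k → d * (k + 1) ≤ nScales β + 1 → d * k ≤ n → ∀ j : ℕ, d * k ≤ j →
      ∀ κ α cr cc : ℝ,
        κ = Real.sqrt (Cκ * (klScale klE0 (d * k) / klScale klE0 (d * k - 1)) * (klE0 * ((8 : ℝ) ^ (d * k - 1))⁻¹)) →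
        α = Cb * ((M : ℝ) / β) / klScale klE0 (d * (k + 1)) →
        cr = 81 * CJ * M / β → cc = 81 * (2 : ℝ) ^ (d * k - (d * k - 1)) * CJ' * M / β →
      hubbardEffPartitionFnCT L M β U μ 0 (klFlowFrameU L M β U μ n) (klScale klE0 (d * k)) ≠ 0 →
      ∀ θ : ℝ, 0 < θ → ∀ D : ℕ, Fintype.card (SpaceTimeIdx L M × SectorLeg (sectorCount (d * k - 1))) / 2 ≤ D →
        256 * Real.exp 1 * Cb * (4 : ℝ) ^ d / Cκ *
          towerV D (Real.exp 1 ^ 4 * (1 + θ) ^ 2 * (2 * Cκ * klE0))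
            (fun m => klTowerMeasWtAt L M β U μ (klFlowFrameU L M β U μ n) d k j (2 * m) / (((2 : ℝ) ^ (5 * (d * k)))⁻¹ * ((8 : ℝ) ^ (d * k)) ^ m)) < 1 →
      ∀ N₀ : ℕ, 2 ≤ N₀ → ∀ q : ℕ,
      klTowerBornWtAt L M β U μ (klFlowFrameU L M β U μ n) d k j (2 * (q + 1)) ≤
        (81 * CJ / 2) * (81 * CJ') ^ (2 * q + 1) * (((8 : ℝ) ^ (d * k)) ^ (q + 1) * ((2 : ℝ) ^ (5 * (d * k)))⁻¹) *
          (towerFO D (2 * Cκ * klE0)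
              (fun m => klTowerMeasWtAt L M β U μ (klFlowFrameU L M β U μ n) d k j (2 * m) / (((2 : ℝ) ^ (5 * (d * k)))⁻¹ * ((8 : ℝ) ^ (d * k)) ^ m)) (q + 1) +
            ∑ n' ∈ Icc 2 (N₀ - 1), Real.exp 1 * (256 * Real.exp 1 * Cb * (4 : ℝ) ^ d / Cκ) ^ (n' - 1) * (1 / (θ ^ 2 * (2 * Cκ * klE0))) ^ (q + 1) *
              towerS D (Real.exp 1 ^ 4 * (1 + θ) ^ 2 * (2 * Cκ * klE0))
                (fun m => klTowerMeasWtAt L M β U μ (klFlowFrameU L M β U μ n) d k j (2 * m) / (((2 : ℝ) ^ (5 * (d * k)))⁻¹ * ((8 : ℝ) ^ (d * k)) ^ m)) n' (q + 1) +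
            (1 / (θ ^ 2 * (2 * Cκ * klE0))) ^ (q + 1) * Real.exp 1 *
              towerV D (Real.exp 1 ^ 4 * (1 + θ) ^ 2 * (2 * Cκ * klE0))
                (fun m => klTowerMeasWtAt L M β U μ (klFlowFrameU L M β U μ n) d k j (2 * m) / (((2 : ℝ) ^ (5 * (d * k)))⁻¹ * ((8 : ℝ) ^ (d * k)) ^ m)) *
              (256 * Real.exp 1 * Cb * (4 : ℝ) ^ d / Cκ *
                towerV D (Real.exp 1 ^ 4 * (1 + θ) ^ 2 * (2 * Cκ * klE0))
                  (fun m => klTowerMeasWtAt L M β U μ (klFlowFrameU L M β U μ n) d k j (2 * m) / (((2 : ℝ) ^ (5 * (d * k)))⁻¹ * ((8 : ℝ) ^ (d * k)) ^ m))) ^ (N₀ - 1) /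
              (1 - 256 * Real.exp 1 * Cb * (4 : ℝ) ^ d / Cκ *
                towerV D (Real.exp 1 ^ 4 * (1 + θ) ^ 2 * (2 * Cκ * klE0))
                  (fun m => klTowerMeasWtAt L M β U μ (klFlowFrameU L M β U μ n) d k j (2 * m) / (((2 : ℝ) ^ (5 * (d * k)))⁻¹ * ((8 : ℝ) ^ (d * k)) ^ m)))) := by
  obtain ⟨Cκ, Cb, CJ, CJ', hCκ, hCb, hCJ, hCJ', hall⟩ := klTowerBornWtAt_le_klEng_all_kit_units d R c'' hc''
  refine ⟨Cκ, Cb, CJ, CJ', hCκ, hCb, hCJ, hCJ', ?_⟩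
  intro G P Q c hP hR2 hc hc6 μ hμ U hU hU9 hcU β hβmin hβc L M _ _ hL3 hM3 n hn1 hnN hreg hhist hfr hosc k hd hk hdk hdk1 hkn j hj
    κ α cr cc hκ hα hcr hcc hZ θ hθ D hD hguard N₀ hN₀ q
  have hβ : 0 < β := KLRegimeSplit.pos_of_klBetaMin_le hβmin
  have hM0 : (0 : ℝ) < M := Nat.cast_pos.2 (Nat.pos_of_ne_zero (NeZero.ne M))
  have hε := imagTimeWeight_pos_of_pos (M := M) hβ
  have hdk' : 1 ≤ d * k := le_trans hd (Nat.le_mul_of_pos_right d hk)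
  have hκpos : 0 < κ := by
    rw [hκ]
    have h1 : 0 < klScale klE0 (d * k) := klth_klScale_pos _
    have h2 : 0 < klScale klE0 (d * k - 1) := klth_klScale_pos _
    have he : (0 : ℝ) < klE0 := by norm_num [klE0]
    exact Real.sqrt_pos.2 (by positivity)
  have hρ : 0 < θ * κ := mul_pos hθ hκpos
  -- units
  set u : ℝ := (8 : ℝ) ^ (d * k) with hu
  set Kc : ℝ := ((2 : ℝ) ^ (5 * (d * k)))⁻¹ with hKc
  have hu0 : 0 < u := by rw [hu]; positivity
  have hKc0 : 0 < Kc := by rw [hKc]; positivity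
  -- dictionary
  have hσ : κ ^ 2 * u = 2 * Cκ * klE0 := by rw [hu]; exact towerDict_sigma hCκ.le hdk' hκ
  have hτ : (Real.exp 2 * (κ + θ * κ)) ^ 2 * u = Real.exp 1 ^ 4 * (1 + θ) ^ 2 * (2 * Cκ * klE0) := towerDict_tau hσ
  have hψ : (θ * κ)⁻¹ ^ 2 / u = 1 / (θ ^ 2 * (2 * Cκ * klE0)) := towerDict_psi hκpos hθ hσ
  have hΦ : Real.exp 1 * α / κ ^ 2 * (imagTimeWeight β M * Kc) = 256 * Real.exp 1 * Cb * (4 : ℝ) ^ d / Cκ := by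
    rw [hKc]; exact towerDict_Phi hCκ hβ hM0 (by rw [hu] at hσ; exact hσ) hα
  have hcr' : imagTimeWeight β M * cr = 81 * CJ / 2 := towerDict_cr hβ.ne' hM0.ne' hcr
  have hcc' : imagTimeWeight β M * cc = 81 * CJ' := towerDict_cc hβ.ne' hM0.ne' hdk' hcc
  -- the absolute guard from the dimensionless one
  have hN := towerInputSizes_units (ε := imagTimeWeight β M) hu0.ne' hKc0.ne'
    (fun m => klTowerMeasWtAt L M β U μ (klFlowFrameU L M β U μ n) d k j m)
  have hguard_abs : Real.exp 1 * α / κ ^ 2 * towerV D ((Real.exp 2 * (κ + θ * κ)) ^ 2)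
      (fun m' => imagTimeWeight β M * klTowerMeasWtAt L M β U μ (klFlowFrameU L M β U μ n) d k j (2 * m')) < 1 := by
    rw [hN, towerV_units, ← mul_assoc, hΦ, hτ]
    exact hguard
  have key := hall G P Q c hP hR2 hc hc6 μ hμ U hU hU9 hcU β hβmin hβc L M hL3 hM3 n hn1 hnN hreg hhist hfr hosc k hd hk hdk hdk1 hkn j hj
    κ α cr cc hκ hα hcr hcc hZ (θ * κ) hρ D hD hguard_abs N₀ hN₀ q u Kc hu0 hKc0
  rw [hσ, hτ, hψ, hΦ, hcr', hcc'] at key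
  exact key

end Summit.HubbardSuperconductivity.HubbardSuperconductivity.Theorems.EngineV8

end
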